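import Summits.ValiantsHypothesis.ValiantsHypothesis.Theorems.KPlusLogSqLawTropicalBCyclePotentialAllK
import Summits.ValiantsHypothesis.ValiantsHypothesis.Theorems.KPlusLogSqLawTropicalBSignsFree

/-!
# Route «KPlusLogSqLaw», crux `TropicalB` (stmt-ValiantsHypothesis-19771) — `TropicalB` ⟺ FEW NON-INVOLUTIVE EXCHANGE STEPS

HONEST FRAMING.  Helper toward the registered stubs `stub_tropThin` / `stub_tropFat` of `Cruxes/TropicalB/Lines/birth.lean` (crux
`Summit.ValiantsHypothesis.ValiantsHypothesis.Theses.KPlusLogSqLaw.TropicalB`, item stmt-ValiantsHypothesis-19771, route KPlusLogSqLaw; cell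
`pub-symmetroid`, seat val-sym-trop-p1 g25, 2026-08-29; `--supports … --as helper`).  A REFORMULATION (kernel iff) of the OPEN crux; nothing is asserted about
`TropicalB`, and nothing bears on `WeakLifting`, DoorA26 / DoorA34, `MatrixDescartes` (stmt-ValiantsHypothesis-18050) or VP ≠ VNP.

By the exponent-free cycle potential law at `c = 2` (`CyclePotential.chain_le_allK_of_exceptions`, p684651: a compatible potential of height `5^K` exists
for EVERY exponent vector) the INVOLUTIVE steps of a dominant chain — those whose exchange quotient `τ_k = σ_k⁻¹σ_{k+1}` satisfies `τ_k² = 1`, i.e. class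
flips and products of disjoint transpositions — are free: between two non-involutive steps a chain spends at most `m·5^K` of them.  Hence

* `tropRowD_of_nonInvolutive_bound` — if in format `(m, K)` every unsigned dominant chain has at most `A` steps with `τ_k² ≠ 1`, then
  `TropRowD m K ((A + 1)·(m·5^K + 1) − 1)`;
* **`tropicalB_iff_nonInvolutiveSteps`** — `TropicalB` ⟺ there is `C` such that in every design every unsigned dominant chain has at most
  `2^(C (K + ⌊log₂ m⌋²))` steps whose exchange quotient is NOT an involution (has a cycle of length `≥ 3`).  So the crux bets exactly on the number of
  exchanges along `3⁺`-cycles; the sibling statement at `c = 1` («few permutation-changing steps», lift-p2's `chain_le_permChanges_add`) is the weaker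
  reading, this one also discounts all transposition steps.
[this cell's law; arithmetic `(2^{CX}+1)(m·5^K+1) ≤ 2^{(C+5)X}` for `X = K + ⌊log₂ m⌋² ≥ 1`]
-/

set_option linter.dupNamespace false
set_option autoImplicit false

namespace Summit.ValiantsHypothesis.ValiantsHypothesis.Theorems.KPlusLogSqLaw

open Summit.ValiantsHypothesis.ValiantsHypothesis.Theorems.MatrixDescartes.Negative
open Summit.ValiantsHypothesis.ValiantsHypothesis.Theses.KPlusLogSqLaw (TropicalB)
open scoped BigOperators
open Finset

namespace CyclePotential

variable {m K : ℕ}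

/-- an involution `τ` (`τ·τ = 1`) has every point in an invariant set of at most two points, `{b, τ b}`. [folklore] -/
theorem exists_invariant_pair_of_involutive (τ : Equiv.Perm (Fin m)) (hτ : τ * τ = 1) (b : Fin m) :
    ∃ T : Finset (Fin m), b ∈ T ∧ T.card ≤ 2 ∧ ∀ x, τ x ∈ T ↔ x ∈ T := by
  classical
  have hττ : ∀ x, τ (τ x) = x := fun x => by
    have h := congrArg (fun σ : Equiv.Perm (Fin m) => σ x) hτ
    simpa using h
  refine ⟨{b, τ b}, by simp, card_insert_le _ _ |>.trans (by simp), fun x => ?_⟩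
  simp only [mem_insert, mem_singleton]
  constructor
  · rintro (h | h)
    · right; rw [← hττ x, h]
    · left; exact τ.injective h
  · rintro (h | h)
    · right; rw [h]
    · left; rw [h, hττ]

/-- **Involutive steps are free.**  If every unsigned dominant chain of format `(m, K)` has at most `A` steps whose exchange quotient is not an
involution, then `TropRowD m K ((A + 1)·(m·5^K + 1) − 1)`. [this cell's law] -/
theorem tropRowD_of_nonInvolutive_bound (m K A : ℕ)
    (h : ∀ (d : Fin K → ℕ) (v ε : Fin m → Fin m → Fin K → ℤ) (n : ℕ) (θ : Fin (n + 1) → ℤ)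
      (p : Fin (n + 1) → Equiv.Perm (Fin m) × (Fin m → Fin K)),
      StrictMono θ → (∀ k, IsDominant d v ε (θ k) (p k)) → (∀ k : Fin n, p k.castSucc ≠ p k.succ) →
      (univ.filter fun k : Fin n =>
        ((p k.castSucc).1⁻¹ * (p k.succ).1) * ((p k.castSucc).1⁻¹ * (p k.succ).1) ≠ 1).card ≤ A) :
    TropRowD m K ((A + 1) * (m * 5 ^ K + 1) - 1) := by
  classical
  intro d v ε n θ p hθ hdom hne
  set J : Finset (Fin n) := univ.filter fun k : Fin n =>
    ((p k.castSucc).1⁻¹ * (p k.succ).1) * ((p k.castSucc).1⁻¹ * (p k.succ).1) ≠ 1 with hJ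
  have hJA : J.card ≤ A := h d v ε n θ p hθ hdom hne
  have horb : ∀ k : Fin n, k ∉ J → ∀ b : Fin m, ∃ T : Finset (Fin m), b ∈ T ∧ T.card ≤ 2 ∧
      ∀ x, ((p k.castSucc).1⁻¹ * (p k.succ).1) x ∈ T ↔ x ∈ T := by
    intro k hk b
    have hinv : ((p k.castSucc).1⁻¹ * (p k.succ).1) * ((p k.castSucc).1⁻¹ * (p k.succ).1) = 1 := by
      by_contra hne1
      exact hk (mem_filter.mpr ⟨mem_univ _, hne1⟩)
    exact exists_invariant_pair_of_involutive _ hinv b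
  have hlaw := chain_le_allK_of_exceptions d v ε 2 θ p hθ hdom hne J horb
  have h5 : (2 * 2 + 1) ^ K = 5 ^ K := by norm_num
  rw [h5] at hlaw
  have hmono : (J.card + 1) * (m * 5 ^ K + 1) ≤ (A + 1) * (m * 5 ^ K + 1) := Nat.mul_le_mul_right _ (by omega)
  have h1 : 1 ≤ (A + 1) * (m * 5 ^ K + 1) := Nat.one_le_iff_ne_zero.mpr (by positivity)
  omega

/-- TB-shape arithmetic: `(2^{CX} + 1)(m·5^K + 1) − 1 ≤ 2^{(C+5)X}` with `X = K + ⌊log₂ m⌋²`, for `K ≥ 1`. [arithmetic] -/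
theorem nonInvolutive_arith (C m K : ℕ) (hK : 1 ≤ K) :
    (2 ^ (C * (K + Nat.log 2 m ^ 2)) + 1) * (m * 5 ^ K + 1) - 1 ≤ 2 ^ ((C + 5) * (K + Nat.log 2 m ^ 2)) := by
  set L := Nat.log 2 m with hL
  set X := K + L ^ 2 with hX
  have hX1 : 1 ≤ X := by omega
  have hm : m + 1 ≤ 2 ^ (L + 1) := Nat.lt_pow_succ_log_self (by norm_num) m
  have hLX : L ≤ L ^ 2 := by nlinarith
  have h5 : 5 ^ K ≤ 2 ^ (3 * K) := by
    rw [pow_mul]; exact Nat.pow_le_pow_left (by norm_num) K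
  have h1 : 2 ^ (C * X) + 1 ≤ 2 ^ (C * X + 1) := by rw [pow_succ]; have := Nat.one_le_two_pow (n := C * X); omega
  have h2 : m * 5 ^ K + 1 ≤ 2 ^ (L + 1) * 2 ^ (3 * K) := by
    calc m * 5 ^ K + 1 ≤ (m + 1) * 5 ^ K := by have := Nat.one_le_pow K 5 (by norm_num); nlinarith
      _ ≤ 2 ^ (L + 1) * 2 ^ (3 * K) := Nat.mul_le_mul hm h5
  calc (2 ^ (C * X) + 1) * (m * 5 ^ K + 1) - 1 ≤ (2 ^ (C * X) + 1) * (m * 5 ^ K + 1) := Nat.sub_le _ _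
    _ ≤ 2 ^ (C * X + 1) * (2 ^ (L + 1) * 2 ^ (3 * K)) := Nat.mul_le_mul h1 h2
    _ = 2 ^ (C * X + 1 + (L + 1) + 3 * K) := by rw [← pow_add, ← pow_add]; ring_nf
    _ ≤ 2 ^ ((C + 5) * X) := Nat.pow_le_pow_right (by norm_num) (by nlinarith)

/-- **`TropicalB` ⟺ few non-involutive exchange steps.**  The crux holds iff there is `C` such that in every design every unsigned dominant chain
(strictly increasing slopes, consecutive terms distinct) has at most `2^(C (K + ⌊log₂ m⌋²))` steps whose exchange quotient `σ_k⁻¹σ_{k+1}` is not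
an involution. [this cell's law] -/
theorem tropicalB_iff_nonInvolutiveSteps :
    TropicalB ↔ ∃ C : ℕ, ∀ (m K : ℕ) (d : Fin K → ℕ) (v ε : Fin m → Fin m → Fin K → ℤ) (n : ℕ) (θ : Fin (n + 1) → ℤ)
      (p : Fin (n + 1) → Equiv.Perm (Fin m) × (Fin m → Fin K)),
      StrictMono θ → (∀ k, IsDominant d v ε (θ k) (p k)) → (∀ k : Fin n, p k.castSucc ≠ p k.succ) →
      (univ.filter fun k : Fin n =>
        ((p k.castSucc).1⁻¹ * (p k.succ).1) * ((p k.castSucc).1⁻¹ * (p k.succ).1) ≠ 1).card ≤ 2 ^ (C * (K + Nat.log 2 m ^ 2)) := by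
  classical
  rw [tropicalB_iff_unsigned]
  constructor
  · rintro ⟨C, hC⟩
    refine ⟨C, fun m K d v ε n θ p hθ hdom hne => ?_⟩
    have hn : n ≤ 2 ^ (C * (K + Nat.log 2 m ^ 2)) := hC m K d v ε n θ p hθ hdom hne
    exact (card_le_univ _).trans (by rw [Fintype.card_fin]; exact hn)
  · rintro ⟨C, hC⟩
    refine ⟨C + 5, fun m K => ?_⟩
    rcases Nat.eq_zero_or_pos K with hK | hK
    · -- no classes: a class map `Fin m → Fin 0` forces `m = 0`, and then there is a single term
      subst hK
      intro d v ε n θ p hθ hdom hne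
      rcases Nat.eq_zero_or_pos m with hm | hm
      · subst hm
        rcases Nat.eq_zero_or_pos n with hn | hn
        · rw [hn]; exact Nat.zero_le _
        · exact absurd (Prod.ext (Equiv.ext fun b => b.elim0) (funext fun b => b.elim0)) (hne ⟨0, hn⟩)
      · exact absurd ((p 0).2 ⟨0, hm⟩).isLt (Nat.not_lt_zero _)
    · exact tropRowD_mono (nonInvolutive_arith C m K hK) (tropRowD_of_nonInvolutive_bound m K _ (hC m K))

end CyclePotential

end Summit.ValiantsHypothesis.ValiantsHypothesis.Theorems.KPlusLogSqLaw
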